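import Literature.AlgebraicGeometry.Dimension.SmoothRelativeDimensionOfClosedPoints
import Literature.AlgebraicGeometry.AbelianSchemes.AbelianSchemeOverBase
import Mathlib.RingTheory.Artinian.Module
import HarnessLib

/-!
# The relative dimension of a smooth lift over an Artin local base is read on the reduction
# ([MumfordFogartyKirwan1994] Ch. 6 §3 Prop. 6.15 / Thm. 6.14: «smooth of relative dimension `g`» for the lifted abelian scheme)

Topic `Literature/AlgebraicGeometry/AbelianSchemes`; namespace `Literature.AlgebraicGeometry.AbelianSchemes.AbelianSchemeOver`.
THEOREMS ONLY (no definition, no named fact, no instance, no notation, no `sorry`; net Literature debt 0).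
Cell hodgecm-mathlib (D-0151), F-11 (A4b) ∕ F-4 II-a packaging brick «RELATIVE DIMENSION OF THE LIFT» (B-plan1 (g19)
2026-08-30 20:14:23Z GO; hand B-p04 (g22)); consumers: F-11 α1∕(A4) `stub_polarizedLift` (output clause `X.IsOfRelDim g`), F-4
II-e assembly.  HC_CM is proved only modulo the 7 printed citations until rung 0 closes; this file discharges none of them.

STATEMENT.  `A` an Artin local ring with residue field `k`, `J ≠ ⊤` an ideal, `q : X → Spec A` SMOOTH, and a cartesian square
`G : X₀ → X` over `Spec (A⧸J) ↪ Spec A` whose base `q₀ : X₀ → Spec (A⧸J)` is smooth of relative dimension `g`.  Then `q` is smooth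
of relative dimension `g` (`smoothOfRelativeDimension_of_isPullback_specMap_mk`); in particular the abelian-scheme structure that
[MumfordFogartyKirwan1994, Prop. 6.15] puts on a lift `X` of an abelian scheme `A₀` of relative dimension `g` has relative
dimension `g` (`IsOfRelDim.of_isPullback_specMap_mk`, the `IsOfRelDim g` clause of the moduli letters [MumfordFogartyKirwan1994,
Ch. 6 §3 Thm. 6.14 «smooth … of relative dimension `g`»]).

PROOF (relative dimension is read on the closed fibre).  Around `x ∈ X` Mathlib's `Smooth` gives a chart `V ∋ x` smooth of SOME
relative dimension `d` (★ `Motives.exists_opens_smoothOfRelativeDimension_of_smooth`).  The closed fibre `X̄ = X₀ ×_{A⧸J} Spec k`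
maps onto `X` (`Spec k → Spec (A⧸J) → Spec A` are surjective: one point each), and its open `f⁻¹V` is a `k`-scheme smooth of
relative dimension `d` (base change of the chart, Mathlib `isPullback_morphismRestrict`) AND `g` (an open of `X̄`, which is a base
change of `q₀`); at a closed point of `f⁻¹V` (Jacobson, ★ `Dimension.exists_mem_isClosed_singleton_of_mem_opens`) both numbers are
`dim 𝒪` (★ `Dimension.ringKrullDim_stalk_eq_of_smoothOfRelativeDimension_of_isClosed`, [GortzWedhorn2020] Lemma 6.26), so
`d = g`; glue by `IsZariskiLocalAtSource`.

## References
* [MumfordFogartyKirwan1994] D. Mumford, J. Fogarty, F. Kirwan, *Geometric Invariant Theory*, 3rd ed., Springer (1994), Ch. 6 §3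
  Thm. 6.14 and Prop. 6.15 (p. 124).
* [GortzWedhorn2020] U. Görtz, T. Wedhorn, *Algebraic Geometry I*, 2nd ed. (2020), Lemma 6.26 and Thm. 6.28 (relative dimension
  at closed points), Prop. 3.35 (closed points very dense).
-/

noncomputable section

universe u

open CategoryTheory CategoryTheory.Limits AlgebraicGeometry TopologicalSpace IsLocalRing

namespace Literature.AlgebraicGeometry.AbelianSchemes.AbelianSchemeOver

/-- **The relative dimension of a smooth morphism to an Artin local base is that of its base change to `Spec (A⧸J)`**:
`q : X → Spec A` smooth, `G : X₀ → X` cartesian over `Spec (A⧸J) ↪ Spec A` (`J ≠ ⊤`) with `q₀ : X₀ → Spec (A⧸J)` smooth of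
relative dimension `g` ⇒ `q` is smooth of relative dimension `g`. [cite: MumfordFogartyKirwan1994, Ch. 6 §3 Proposition 6.15 (p. 124)]
[cite: GortzWedhorn2020, Lemma 6.26 and Thm. 6.28 (vi)] -/
theorem smoothOfRelativeDimension_of_isPullback_specMap_mk {A : Type u} [CommRing A] [IsArtinianRing A] [IsLocalRing A]
    {J : Ideal A} (hJ : J ≠ ⊤) {X₀ X : Scheme.{u}} {q₀ : X₀ ⟶ Spec (.of (A ⧸ J))} {q : X ⟶ Spec (.of A)} {G : X₀ ⟶ X}
    (hG : IsPullback G q₀ q (Spec.map (CommRingCat.ofHom (Ideal.Quotient.mk J)))) [Smooth q] (g : ℕ)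
    [hg : SmoothOfRelativeDimension g q₀] : SmoothOfRelativeDimension g q := by
  haveI := smoothOfRelativeDimension_isStableUnderBaseChange (n := g)
  -- the closed fibre through `Spec k → Spec (A⧸J)`
  let k := ResidueField A
  have hker : ∀ a ∈ J, residue A a = 0 := fun a ha => (residue_eq_zero_iff a).2 (le_maximalIdeal hJ ha)
  let σ₀ : Spec (.of k) ⟶ Spec (.of (A ⧸ J)) := Spec.map (CommRingCat.ofHom (Ideal.Quotient.lift J (residue A) hker))
  let qk : pullback q₀ σ₀ ⟶ Spec (.of k) := pullback.snd q₀ σ₀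
  let f : pullback q₀ σ₀ ⟶ X := pullback.fst q₀ σ₀ ≫ G
  have Hsq : IsPullback f qk q (σ₀ ≫ Spec.map (CommRingCat.ofHom (Ideal.Quotient.mk J))) :=
    (IsPullback.of_hasPullback q₀ σ₀).paste_horiz hG
  haveI : SmoothOfRelativeDimension g qk := MorphismProperty.pullback_snd (P := @SmoothOfRelativeDimension g) q₀ σ₀ hg
  haveI : Smooth qk := SmoothOfRelativeDimension.smooth g qk
  -- `f : X̄ → X` is surjective (one point downstairs at each stage)
  have hsub : ∀ (R : Type u) [CommRing R] [IsLocalRing R], (∀ p : Ideal R, p.IsPrime → p.IsMaximal) →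
      Subsingleton ↥(Spec (CommRingCat.of R)) := fun R _ _ h =>
    ⟨fun p q => PrimeSpectrum.ext ((eq_maximalIdeal (h _ p.2)).trans (eq_maximalIdeal (h _ q.2)).symm)⟩
  haveI : Subsingleton ↥(Spec (CommRingCat.of A)) := hsub A fun p hp => IsArtinianRing.isMaximal_of_isPrime p
  haveI : Nontrivial (A ⧸ J) := Ideal.Quotient.nontrivial_iff.mpr hJ
  haveI : IsArtinianRing (A ⧸ J) := inferInstance
  haveI : IsLocalRing (A ⧸ J) := IsLocalRing.of_surjective' (Ideal.Quotient.mk J) Ideal.Quotient.mk_surjective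
  haveI : Subsingleton ↥(Spec (CommRingCat.of (A ⧸ J))) := hsub (A ⧸ J) fun p hp => IsArtinianRing.isMaximal_of_isPrime p
  haveI : Nonempty ↥(Spec (CommRingCat.of k)) := inferInstanceAs (Nonempty (PrimeSpectrum k))
  haveI : Nonempty ↥(Spec (CommRingCat.of (A ⧸ J))) := inferInstanceAs (Nonempty (PrimeSpectrum (A ⧸ J)))
  haveI : Surjective σ₀ := ⟨fun y => ⟨Classical.arbitrary _, Subsingleton.elim _ _⟩⟩
  haveI : Surjective (Spec.map (CommRingCat.ofHom (Ideal.Quotient.mk J))) :=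
    ⟨fun y => ⟨Classical.arbitrary _, Subsingleton.elim _ _⟩⟩
  haveI : Surjective G := MorphismProperty.of_isPullback hG.flip ‹_›
  haveI : Surjective (pullback.fst q₀ σ₀) := MorphismProperty.pullback_fst q₀ σ₀ ‹Surjective σ₀›
  haveI : Surjective f := inferInstance
  -- local relative dimensions of `q` all equal `g`
  have key : ∀ x : X, ∃ V : X.Opens, x ∈ V ∧ SmoothOfRelativeDimension g (V.ι ≫ q) := by
    intro x
    obtain ⟨V, d, hxV, hd⟩ := Literature.AlgebraicGeometry.Motives.exists_opens_smoothOfRelativeDimension_of_smooth q x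
    -- the open `f⁻¹V` of the closed fibre, over `k`: smooth of relative dimension `d` …
    have S : IsPullback (f ∣_ V) ((f ⁻¹ᵁ V).ι ≫ qk) (V.ι ≫ q) (σ₀ ≫ Spec.map (CommRingCat.ofHom (Ideal.Quotient.mk J))) :=
      (isPullback_morphismRestrict f V).paste_vert Hsq
    haveI hd' : SmoothOfRelativeDimension d ((f ⁻¹ᵁ V).ι ≫ qk) := by
      haveI := smoothOfRelativeDimension_isStableUnderBaseChange (n := d)
      haveI := hd
      exact MorphismProperty.of_isPullback (P := @SmoothOfRelativeDimension d) S hd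
    -- … and of relative dimension `g`
    have hg' : SmoothOfRelativeDimension g ((f ⁻¹ᵁ V).ι ≫ qk) := by
      have h := (inferInstance : SmoothOfRelativeDimension (0 + g) ((f ⁻¹ᵁ V).ι ≫ qk))
      rwa [Nat.zero_add] at h
    -- a closed point of `f⁻¹V` (non-empty since `f` is surjective; Jacobson)
    obtain ⟨w, hw⟩ := f.surjective x
    have hwV : w ∈ f ⁻¹ᵁ V := by show f.base w ∈ V; rw [hw]; exact hxV
    haveI : LocallyOfFiniteType ((f ⁻¹ᵁ V).ι ≫ qk) := inferInstance
    obtain ⟨w', -, hw'⟩ := Literature.AlgebraicGeometry.Dimension.exists_mem_isClosed_singleton_of_mem_opens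
      ((f ⁻¹ᵁ V).ι ≫ qk) (U := ⊤) (x := (⟨w, hwV⟩ : ↥(f ⁻¹ᵁ V))) trivial
    have h1 := Literature.AlgebraicGeometry.Dimension.ringKrullDim_stalk_eq_of_smoothOfRelativeDimension_of_isClosed
      ((f ⁻¹ᵁ V).ι ≫ qk) d hw'
    have h2 := @Literature.AlgebraicGeometry.Dimension.ringKrullDim_stalk_eq_of_smoothOfRelativeDimension_of_isClosed
      _ _ _ ((f ⁻¹ᵁ V).ι ≫ qk) g hg' _ hw'
    rw [h1] at h2
    have hdg : d = g := by exact_mod_cast h2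
    exact ⟨V, hxV, hdg ▸ hd⟩
  choose V hxV hV using key
  have htop : ⨆ x, V x = ⊤ := top_le_iff.mp fun x _ => Opens.mem_iSup.mpr ⟨x, hxV x⟩
  rw [IsZariskiLocalAtSource.iff_of_iSup_eq_top (P := @SmoothOfRelativeDimension g) V htop]
  exact hV

/-- **The lift of an abelian scheme of relative dimension `g` has relative dimension `g`**: for abelian schemes
`A₀ ∕ Spec (A⧸J)` and `𝒳 ∕ Spec A` (`A` Artin local, `J ≠ ⊤`) related by a cartesian square `G : A₀.X → 𝒳.X` over
`Spec (A⧸J) ↪ Spec A` (e.g. ★ `IsBaseChangeVia`), `A₀.IsOfRelDim g → 𝒳.IsOfRelDim g` — the `IsOfRelDim g` clause of the lifted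
abelian scheme of [MumfordFogartyKirwan1994] Prop. 6.15. [cite: MumfordFogartyKirwan1994, Ch. 6 §3 Proposition 6.15 (p. 124) and Theorem 6.14 (p. 124)] -/
theorem IsOfRelDim.of_isPullback_specMap_mk {A : Type u} [CommRing A] [IsArtinianRing A] [IsLocalRing A] {J : Ideal A}
    (hJ : J ≠ ⊤) (A₀ : AbelianSchemeOver (Spec (.of (A ⧸ J)))) (𝒳 : AbelianSchemeOver (Spec (.of A)))
    {G : A₀.X.left ⟶ 𝒳.X.left} (hG : IsPullback G A₀.X.hom 𝒳.X.hom (Spec.map (CommRingCat.ofHom (Ideal.Quotient.mk J))))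
    {g : ℕ} (h : A₀.IsOfRelDim g) : 𝒳.IsOfRelDim g := by
  haveI := 𝒳.isSmooth
  haveI : SmoothOfRelativeDimension g A₀.X.hom := h
  exact smoothOfRelativeDimension_of_isPullback_specMap_mk hJ hG g

end Literature.AlgebraicGeometry.AbelianSchemes.AbelianSchemeOver

end
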